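import Literature.Computability.Complexity.GateEliminationWires

/-!
# Gate elimination: gates untouched by one elimination keep their status

Bookkeeping lemmas for the exact elimination data `ElimDataW` of `GateEliminationWires.lean`,
used in the sub-case analyses of Case 5 of Li–Yang's Theorem 4.1 (ECCC TR21-023, §4.1): the
out-degree of a variable or gate not read by the eliminated gate and not the replacement node is
unchanged; the wires of a gate not reading the eliminated gate are the pull-backs of the old
ones; hence such an *untouched* gate is troubled afterwards iff it was troubled before. The same
for a constant substitution to a variable the gate does not read.

## References

* J. Li, T. Yang, *3.1n − o(n) circuit lower bounds for explicit functions*, STOC 2022;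
  ECCC TR21-023, §3.3 (Lemma 3.11), §4.1 (Case 5).
-/

namespace Literature.Computability.Complexity

open Finset

namespace Semicircuit

variable {n : ℕ} {C : Semicircuit n}

namespace ElimDataW

variable {k₀ : Fin C.m} {f : (Fin n → ZMod 2) → Bool} {R : RdqSource n}
  {αφ αI αQ : ℝ} {P : Finset (Fin C.m × Fin C.m)} {δ : ℝ} (E : ElimDataW C k₀ f R αφ αI αQ P δ)

/-- Out-degree of a variable not read by `k₀` and not the replacement node. [folklore] -/
theorem fanout_var_eq {i : Fin n} (hk : ∀ a, C.arg k₀ a ≠ .var i) (hr : E.repl ≠ .var i) :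
    E.C'.fanout (.var i) = C.fanout (.var i) := by
  have h1 := E.fanout_var_add hr
  have h2 : (univ.filter fun a : Fin 2 => C.arg k₀ a = .var i).card = 0 := by
    rw [card_eq_zero, filter_eq_empty_iff]; exact fun a _ h => hk a h
  omega

/-- Out-degree of a kept gate not read by `k₀` and not the replacement node. [folklore] -/
theorem fanout_gate_eq {k' : Fin E.C'.m} (hk : ∀ a, C.arg k₀ a ≠ .gate (E.ι k')) (hr : E.repl ≠ .gate (E.ι k')) :
    E.C'.fanout (.gate k') = C.fanout (.gate (E.ι k')) := by
  have h1 := E.fanout_gate_add hr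
  have h2 : (univ.filter fun a : Fin 2 => C.arg k₀ a = .gate (E.ι k')).card = 0 := by
    rw [card_eq_zero, filter_eq_empty_iff]; exact fun a _ h => hk a h
  omega

/-- The wires of a gate not reading `k₀` are the pull-backs of the old ones. [folklore] -/
theorem arg_eq_pull {k' : Fin E.C'.m} (h : ∀ a, C.arg (E.ι k') a ≠ .gate k₀) (a : Fin 2) :
    E.C'.arg k' a = E.pull (C.arg (E.ι k') a) := by
  rw [E.arg_eq', if_neg (h a)]

/-- A gate not reading `k₀` reads a variable iff it did. [folklore] -/
theorem arg_eq_var_iff_of_not_reads {k' : Fin E.C'.m} (h : ∀ a, C.arg (E.ι k') a ≠ .gate k₀) (a : Fin 2) (i : Fin n) :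
    E.C'.arg k' a = .var i ↔ C.arg (E.ι k') a = .var i := by
  rw [E.arg_eq_var_iff]
  exact ⟨fun h' => h'.elim id fun h'' => absurd h''.1 (h a), Or.inl⟩

/-- Transporting "the wires are exactly `x`, `y`" along a pointwise equivalence. [folklore] -/
theorem range_eq_pair_iff {m m' : ℕ} (g : Fin 2 → Node n m) (g' : Fin 2 → Node n m')
    (hw : ∀ a i, g' a = .var i ↔ g a = .var i) (x y : Fin n) :
    Set.range g' = {Node.var x, Node.var y} ↔ Set.range g = {Node.var x, Node.var y} := by
  constructor
  · intro hr
    have hvar : ∀ a, ∃ i, g' a = .var i ∧ (i = x ∨ i = y) := by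
      intro a
      have : g' a ∈ Set.range g' := ⟨a, rfl⟩
      rw [hr] at this
      rcases this with h | h
      · exact ⟨x, h, Or.inl rfl⟩
      · exact ⟨y, h, Or.inr rfl⟩
    ext v
    constructor
    · rintro ⟨a, rfl⟩
      obtain ⟨i, hi, hixy⟩ := hvar a
      rw [(hw a i).mp hi]
      rcases hixy with rfl | rfl
      · exact Or.inl rfl
      · exact Or.inr rfl
    · intro hv
      rcases hv with rfl | rfl
      · have : (Node.var x : Node n m') ∈ Set.range g' := by rw [hr]; exact Or.inl rfl
        obtain ⟨a, ha⟩ := this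
        exact ⟨a, (hw a x).mp ha⟩
      · have : (Node.var y : Node n m') ∈ Set.range g' := by rw [hr]; exact Or.inr rfl
        obtain ⟨a, ha⟩ := this
        exact ⟨a, (hw a y).mp ha⟩
  · intro hr
    have hvar : ∀ a, ∃ i, g a = .var i ∧ (i = x ∨ i = y) := by
      intro a
      have : g a ∈ Set.range g := ⟨a, rfl⟩
      rw [hr] at this
      rcases this with h | h
      · exact ⟨x, h, Or.inl rfl⟩
      · exact ⟨y, h, Or.inr rfl⟩
    ext v
    constructor
    · rintro ⟨a, rfl⟩
      obtain ⟨i, hi, hixy⟩ := hvar a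
      rw [(hw a i).mpr hi]
      rcases hixy with rfl | rfl
      · exact Or.inl rfl
      · exact Or.inr rfl
    · intro hv
      rcases hv with rfl | rfl
      · have : (Node.var x : Node n m) ∈ Set.range g := by rw [hr]; exact Or.inl rfl
        obtain ⟨a, ha⟩ := this
        exact ⟨a, (hw a x).mpr ha⟩
      · have : (Node.var y : Node n m) ∈ Set.range g := by rw [hr]; exact Or.inr rfl
        obtain ⟨a, ha⟩ := this
        exact ⟨a, (hw a y).mpr ha⟩

/-- **An untouched gate is troubled afterwards iff it was troubled**: it does not read `k₀`,
`k₀` does not read it nor its variables, and the replacement node is neither it nor one of its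
variables. [cite: LiYang2022, Lemma 3.11] -/
theorem troubled_iff_of_untouched {k' : Fin E.C'.m} (h1 : ∀ a, C.arg (E.ι k') a ≠ .gate k₀)
    (h2 : ∀ a i, C.arg (E.ι k') a = .var i → (∀ b, C.arg k₀ b ≠ .var i) ∧ E.repl ≠ .var i)
    (h3 : ∀ a, C.arg k₀ a ≠ .gate (E.ι k')) (h4 : E.repl ≠ .gate (E.ι k')) :
    E.C'.Troubled k' ↔ C.Troubled (E.ι k') := by
  have hw := E.arg_eq_var_iff_of_not_reads h1
  have hfg := E.fanout_gate_eq h3 h4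
  have hrange := range_eq_pair_iff (C.arg (E.ι k')) (E.C'.arg k') hw
  have hfv : ∀ i, (∃ a, C.arg (E.ι k') a = .var i) → E.C'.fanout (.var i) = C.fanout (.var i) := by
    rintro i ⟨a, ha⟩
    obtain ⟨hk, hr⟩ := h2 a i ha
    exact E.fanout_var_eq hk hr
  have hmemx : ∀ {x y : Fin n}, Set.range (C.arg (E.ι k')) = {Node.var x, Node.var y} → ∃ a, C.arg (E.ι k') a = .var x := by
    intro x y hr
    have : (Node.var x : Node n C.m) ∈ Set.range (C.arg (E.ι k')) := by rw [hr]; exact Or.inl rfl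
    exact this
  have hmemy : ∀ {x y : Fin n}, Set.range (C.arg (E.ι k')) = {Node.var x, Node.var y} → ∃ a, C.arg (E.ι k') a = .var y := by
    intro x y hr
    have : (Node.var y : Node n C.m) ∈ Set.range (C.arg (E.ι k')) := by rw [hr]; exact Or.inr rfl
    exact this
  constructor
  · rintro ⟨hand, hf1, x, y, hxy, hr, hx, hy⟩
    have hrC := (hrange x y).mp hr
    refine ⟨(E.isAndOp_iff k').mp hand, by rw [← hfg]; exact hf1, x, y, hxy, hrC, ?_, ?_⟩
    · rw [← hfv x (hmemx hrC)]; exact hx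
    · rw [← hfv y (hmemy hrC)]; exact hy
  · rintro ⟨hand, hf1, x, y, hxy, hr, hx, hy⟩
    refine ⟨(E.isAndOp_iff k').mpr hand, by rw [hfg]; exact hf1, x, y, hxy, (hrange x y).mpr hr, ?_, ?_⟩
    · rw [hfv x (hmemx hr)]; exact hx
    · rw [hfv y (hmemy hr)]; exact hy

end ElimDataW

/-! ### The same for a constant substitution -/

section SubstConst

variable (C) (j : Fin n) (b : Bool)

/-- **A gate not reading `x_j` is troubled after `x_j := b` iff it was troubled.** [cite: LiYang2022, Lemma 3.11] -/
theorem troubled_substConst_iff_of_not_reads {k : Fin C.m} (h : ∀ a, C.arg k a ≠ .var j) :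
    (C.substConst j b).Troubled k ↔ C.Troubled k := by
  refine ⟨fun hT => troubled_of_troubled_substConst (C := C) hT, ?_⟩
  rintro ⟨hand, hf1, x, y, hxy, hr, hx, hy⟩
  have hw : ∀ a, (C.substConst j b).arg k a = C.arg k a := fun a => by rw [substConst_arg_of_not_reads (C := C) (j := j) (b := b) h]
  have hxj : x ≠ j := by
    rintro rfl
    have : (Node.var x : Node n C.m) ∈ Set.range (C.arg k) := by rw [hr]; exact Or.inl rfl
    obtain ⟨a, ha⟩ := this
    exact h a ha
  have hyj : y ≠ j := by
    rintro rfl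
    have : (Node.var y : Node n C.m) ∈ Set.range (C.arg k) := by rw [hr]; exact Or.inr rfl
    obtain ⟨a, ha⟩ := this
    exact h a ha
  have hw' : ∀ a i, (C.substConst j b).arg k a = .var i ↔ C.arg k a = .var i := fun a i => by rw [hw a]
  refine ⟨hand, by rw [C.fanout_substConst_gate]; exact hf1, x, y, hxy,
    (ElimDataW.range_eq_pair_iff (C.arg k) ((C.substConst j b).arg k) hw' x y).mpr hr, ?_, ?_⟩
  · rw [C.fanout_substConst_var_of_ne j _ hxj]; exact hx
  · rw [C.fanout_substConst_var_of_ne j _ hyj]; exact hy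

end SubstConst

end Semicircuit

end Literature.Computability.Complexity
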